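import Summits.QuantumFields.QCD.Theorems.QuarksAsStableActionUnquenchedChessboardBoundStubAssemblyAux2
import Mathlib
import HarnessLib

/-!
# Assembly of the unquenched chessboard bound, part 3: axis exchange
(stub `stub_assembly` of crux stmt-QuantumFields-9735, line Sketch; auxiliary file 3)

* The exchange `σᵢ` of the time axis with axis `i` on gauge fields, `(σᵢU)(x, j) = U(x ∘ s, s j)`,
  `s = swap 0 i`: it preserves the product Haar measure and maps plaquette holonomies to
  plaquette holonomies (up to orientation), so a word functional built from an `σᵢ`-invariant
  weight is invariant under the induced relabelling of words; this transports the two reflection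
  hypotheses of the chessboard estimate from the time axis to every axis.
All statements here are proved; no definitions are introduced.
-/

noncomputable section

open MeasureTheory Matrix Complex Finset
open Literature.MathematicalPhysics.QuantumFieldTheory Literature.MathematicalPhysics.QuantumLattice
open scoped ComplexConjugate BigOperators ComplexOrder

namespace Summit.QuantumFields.QCD.Theorems.UnquenchedChessboardBoundLine

section Swap

variable {L N : ℕ} [NeZero L]
variable {G : Type*} [Group G] [TopologicalSpace G] [IsTopologicalGroup G] [CompactSpace G]
  [MeasurableSpace G] [BorelSpace G]
variable (ρ : G →* Matrix (Fin N) (Fin N) ℂ) (δ : ℝ)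
variable {κ : Type*} [DecidableEq κ] (pos : (Fin 4 → ZMod L) → κ → Plaquette 4 L)

/-! ## The axis exchange on gauge fields -/

omit [NeZero L] in
/-- The exchange of axes `0 ↔ i` on links is an involution. -/
theorem asm_edgeSwap_involutive (i : Fin 4) :
    Function.Involutive fun e : Edge 4 L =>
      ((e.1 ∘ Equiv.swap (0 : Fin 4) i : Site 4 L), Equiv.swap (0 : Fin 4) i e.2) := by
  intro e
  ext k
  · simp [Function.comp_apply, Equiv.swap_apply_self]
  · simp [Equiv.swap_apply_self]

omit [TopologicalSpace G] [IsTopologicalGroup G] [CompactSpace G] [BorelSpace G] [Group G] in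
/-- **The axis exchange preserves the product Haar measure** (a permutation of the coordinates). -/
theorem asm_integral_comp_axisSwap (μ₀ : Measure G) [IsProbabilityMeasure μ₀] (i : Fin 4)
    (g : GaugeConfig 4 L G → ℂ) :
    ∫ U, g (fun e => U (e.1 ∘ Equiv.swap (0 : Fin 4) i, Equiv.swap (0 : Fin 4) i e.2))
        ∂(Measure.pi fun _ : Edge 4 L => μ₀) =
      ∫ U, g U ∂(Measure.pi fun _ : Edge 4 L => μ₀) := by
  set ε : Equiv.Perm (Edge 4 L) := Function.Involutive.toPerm _ (asm_edgeSwap_involutive (L := L) i)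
  have hmp : MeasurePreserving (MeasurableEquiv.arrowCongr' ε (MeasurableEquiv.refl G))
      (Measure.pi fun _ : Edge 4 L => μ₀) (Measure.pi fun _ : Edge 4 L => μ₀) :=
    measurePreserving_arrowCongr' (fun _ : Edge 4 L => μ₀) (fun _ : Edge 4 L => μ₀) ε
      (MeasurableEquiv.refl G) fun _ => MeasurePreserving.id _
  have h := hmp.integral_comp (MeasurableEquiv.arrowCongr' ε (MeasurableEquiv.refl G)).measurableEmbedding g
  exact h

omit [NeZero L] in
/-- Shifts and the coordinate exchange: `(x + ê_j) ∘ s = (x ∘ s) + ê_{s j}`. -/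
theorem asm_shift_comp_swap (x : Site 4 L) (i j : Fin 4) :
    ((x.shift j) ∘ Equiv.swap (0 : Fin 4) i : Site 4 L) =
      Site.shift (x ∘ Equiv.swap (0 : Fin 4) i) (Equiv.swap (0 : Fin 4) i j) := by
  funext l
  simp only [Site.shift, Function.comp_apply, Pi.add_apply, Pi.single_apply, Equiv.swap_apply_eq_iff]

omit [NeZero L] [TopologicalSpace G] [IsTopologicalGroup G] [CompactSpace G] [MeasurableSpace G]
  [BorelSpace G] in
/-- Plaquette holonomies of the exchanged field. -/
theorem asm_plaquetteHolonomy_axisSwap (i : Fin 4) (U : GaugeConfig 4 L G) (x : Site 4 L) (j k : Fin 4) :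
    plaquetteHolonomy (fun e => U (e.1 ∘ Equiv.swap (0 : Fin 4) i, Equiv.swap (0 : Fin 4) i e.2)) x j k =
      plaquetteHolonomy U (x ∘ Equiv.swap (0 : Fin 4) i) (Equiv.swap (0 : Fin 4) i j)
        (Equiv.swap (0 : Fin 4) i k) := by
  simp only [plaquetteHolonomy, asm_shift_comp_swap]

omit [NeZero L] [TopologicalSpace G] [IsTopologicalGroup G] [CompactSpace G] [MeasurableSpace G]
  [BorelSpace G] in
/-- Reversing the orientation of a plaquette inverts its holonomy. -/
theorem asm_plaquetteHolonomy_symm (U : GaugeConfig 4 L G) (x : Site 4 L) (j k : Fin 4) :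
    plaquetteHolonomy U x k j = (plaquetteHolonomy U x j k)⁻¹ := by
  simp only [plaquetteHolonomy]
  group

omit [NeZero L] [MeasurableSpace G] [BorelSpace G] in
/-- `Re tr` of a plaquette holonomy is orientation blind. -/
theorem asm_re_trace_plaquetteHolonomy_symm (hρ : Continuous ρ) (U : GaugeConfig 4 L G) (x : Site 4 L)
    (j k : Fin 4) :
    (ρ (plaquetteHolonomy U x k j)).trace.re = (ρ (plaquetteHolonomy U x j k)).trace.re := by
  rw [asm_plaquetteHolonomy_symm,
    Literature.RepresentationTheory.CompactGroups.CompactGroup.re_trace_map_inv ρ hρ]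

/-! ## Transport of word functionals under the axis exchange -/

omit [NeZero L] [TopologicalSpace G] [IsTopologicalGroup G] [CompactSpace G] [MeasurableSpace G]
  [BorelSpace G] in
/-- The event of a word for the exchanged field is the event of the relabelled word. -/
theorem asm_wordEvent_axisSwap (i : Fin 4) {sw : κ → κ}
    (hsw : ∀ (U : GaugeConfig 4 L G) c q,
      plaquetteDeficit ρ (fun e => U (e.1 ∘ Equiv.swap (0 : Fin 4) i, Equiv.swap (0 : Fin 4) i e.2))
        (pos c q) = plaquetteDeficit ρ U (pos (c ∘ Equiv.swap (0 : Fin 4) i) (sw q)))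
    (w : (Fin 4 → ZMod L) → Finset κ) (U : GaugeConfig 4 L G) :
    (fun e => U (e.1 ∘ Equiv.swap (0 : Fin 4) i, Equiv.swap (0 : Fin 4) i e.2)) ∈
        {U : GaugeConfig 4 L G | ∀ c, ∀ q ∈ w c, δ ≤ plaquetteDeficit ρ U (pos c q)} ↔
      U ∈ {U : GaugeConfig 4 L G | ∀ c, ∀ q ∈ (w (c ∘ Equiv.swap (0 : Fin 4) i)).image sw,
        δ ≤ plaquetteDeficit ρ U (pos c q)} := by
  simp only [Set.mem_setOf_eq, hsw, Finset.forall_mem_image]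
  have hc : ∀ c : Fin 4 → ZMod L,
      ((c ∘ Equiv.swap (0 : Fin 4) i) ∘ Equiv.swap (0 : Fin 4) i : Fin 4 → ZMod L) = c := fun c => by
    funext l; simp [Equiv.swap_apply_self]
  constructor
  · intro h c q hq
    have h' := h (c ∘ Equiv.swap (0 : Fin 4) i) q hq
    rwa [hc] at h'
  · intro h c q hq
    have hq' : q ∈ w ((c ∘ Equiv.swap (0 : Fin 4) i) ∘ Equiv.swap (0 : Fin 4) i) := by rwa [hc]
    exact h (c ∘ Equiv.swap (0 : Fin 4) i) hq'

/-- **Invariance of the word functional under the axis relabelling** `w ↦ (c ↦ sw[w (c ∘ s)])`,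
for an exchange-covariant placement and an exchange-invariant weight. -/
theorem asm_phi_axisSwap (i : Fin 4) {sw : κ → κ}
    (hsw : ∀ (U : GaugeConfig 4 L G) c q,
      plaquetteDeficit ρ (fun e => U (e.1 ∘ Equiv.swap (0 : Fin 4) i, Equiv.swap (0 : Fin 4) i e.2))
        (pos c q) = plaquetteDeficit ρ U (pos (c ∘ Equiv.swap (0 : Fin 4) i) (sw q)))
    (W : GaugeConfig 4 L G → ℂ)
    (hW : ∀ U, W (fun e => U (e.1 ∘ Equiv.swap (0 : Fin 4) i, Equiv.swap (0 : Fin 4) i e.2)) = W U)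
    (w : (Fin 4 → ZMod L) → Finset κ) :
    (∫ U, {U : GaugeConfig 4 L G | ∀ c, ∀ q ∈ (w (c ∘ Equiv.swap (0 : Fin 4) i)).image sw,
        δ ≤ plaquetteDeficit ρ U (pos c q)}.indicator 1 U * W U
        ∂(Measure.pi fun _ : Edge 4 L => haarProbability G)).re =
      (∫ U, {U : GaugeConfig 4 L G | ∀ c, ∀ q ∈ w c, δ ≤ plaquetteDeficit ρ U (pos c q)}.indicator 1 U
        * W U ∂(Measure.pi fun _ : Edge 4 L => haarProbability G)).re := by
  rw [← asm_integral_comp_axisSwap (haarProbability G) i (fun U =>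
    {U : GaugeConfig 4 L G | ∀ c, ∀ q ∈ w c, δ ≤ plaquetteDeficit ρ U (pos c q)}.indicator 1 U * W U)]
  congr 2
  funext U
  rw [hW]
  congr 1
  by_cases hU : U ∈ {U : GaugeConfig 4 L G | ∀ c, ∀ q ∈ (w (c ∘ Equiv.swap (0 : Fin 4) i)).image sw,
      δ ≤ plaquetteDeficit ρ U (pos c q)}
  · rw [Set.indicator_of_mem hU, Set.indicator_of_mem ((asm_wordEvent_axisSwap ρ δ pos i hsw w U).2 hU)]
    rfl
  · rw [Set.indicator_of_notMem hU,
      Set.indicator_of_notMem (fun h => hU ((asm_wordEvent_axisSwap ρ δ pos i hsw w U).1 h))]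

omit [NeZero L] in
/-- The relabelled reflected half-word in axis `i` is the reflected half-word in the time axis of
the relabelled word (first kind). -/
theorem asm_swapWord_half₁ (i : Fin 4) {sw fli fl0 : κ → κ} (hcomm : ∀ q, sw (fli q) = fl0 (sw q))
    (w : (Fin 4 → ZMod L) → Finset κ) :
    (fun c => ((fun c => if (c i).val < L / 2 then w c
        else (w (Function.update c i (-1 - c i))).image fli) (c ∘ Equiv.swap (0 : Fin 4) i)).image sw) =
      fun c => if (c 0).val < L / 2 then (w (c ∘ Equiv.swap (0 : Fin 4) i)).image sw
        else ((w (Function.update c 0 (-1 - c 0) ∘ Equiv.swap (0 : Fin 4) i)).image sw).image fl0 := by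
  funext c
  have h0 : (c ∘ Equiv.swap (0 : Fin 4) i) i = c 0 := by simp
  have hu : Function.update (c ∘ Equiv.swap (0 : Fin 4) i) i (-1 - c 0) =
      Function.update c 0 (-1 - c 0) ∘ Equiv.swap (0 : Fin 4) i := by
    rw [← Function.update_comp_eq_of_injective c (Equiv.swap (0 : Fin 4) i).injective i (-1 - c 0)]
    simp
  simp only [h0]
  split_ifs
  · rfl
  · rw [hu, Finset.image_image, Finset.image_image]
    exact Finset.image_congr fun q _ => hcomm q

omit [NeZero L] in
/-- The relabelled reflected half-word in axis `i` is the reflected half-word in the time axis of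
the relabelled word (second kind). -/
theorem asm_swapWord_half₂ (i : Fin 4) {sw fli fl0 : κ → κ} (hcomm : ∀ q, sw (fli q) = fl0 (sw q))
    (w : (Fin 4 → ZMod L) → Finset κ) :
    (fun c => ((fun c => if (c i).val < L / 2 then (w (Function.update c i (-1 - c i))).image fli
        else w c) (c ∘ Equiv.swap (0 : Fin 4) i)).image sw) =
      fun c => if (c 0).val < L / 2
        then ((w (Function.update c 0 (-1 - c 0) ∘ Equiv.swap (0 : Fin 4) i)).image sw).image fl0
        else (w (c ∘ Equiv.swap (0 : Fin 4) i)).image sw := by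
  funext c
  have h0 : (c ∘ Equiv.swap (0 : Fin 4) i) i = c 0 := by simp
  have hu : Function.update (c ∘ Equiv.swap (0 : Fin 4) i) i (-1 - c 0) =
      Function.update c 0 (-1 - c 0) ∘ Equiv.swap (0 : Fin 4) i := by
    rw [← Function.update_comp_eq_of_injective c (Equiv.swap (0 : Fin 4) i).injective i (-1 - c 0)]
    simp
  simp only [h0]
  split_ifs
  · rw [hu, Finset.image_image, Finset.image_image]
    exact Finset.image_congr fun q _ => hcomm q
  · rfl

end Swap

section MainAxis

/-- **Reflection hypotheses of the chessboard estimate in every axis**, transported from the time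
axis (`chess_axis0`) along the axis exchange `σᵢ`: for an exchange-covariant placement whose
letter relabelling `sw` intertwines the axis-`i` flip with the time flip, and an exchange-invariant
weight. -/
theorem chess_axis {L N : ℕ} [NeZero L] {G : Type*} [Group G] [TopologicalSpace G]
    [IsTopologicalGroup G] [CompactSpace G] [MeasurableSpace G] [BorelSpace G]
    (ρ : G →* Matrix (Fin N) (Fin N) ℂ) (δ : ℝ) {κ : Type*} [DecidableEq κ]
    (pos : (Fin 4 → ZMod L) → κ → Plaquette 4 L)
    [Fact (1 < L)] (hL : Even L) (hρ : Continuous ρ) (i : Fin 4)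
    {fl0 fli sw : κ → κ} (hfl0 : Function.Involutive fl0)
    (hpr : ∀ c q, WilsonSiteRP.sitePlaqReflect (pos c q) = pos (Function.update c 0 (-1 - c 0)) (fl0 q))
    (hloc : ∀ c q, (c 0).val < L / 2 →
      WilsonSiteRP.IsSitePosPlaq (pos c q) ∨ WilsonSiteRP.IsSharedPlaq (pos c q))
    (hsw : ∀ (U : GaugeConfig 4 L G) c q,
      plaquetteDeficit ρ (fun e => U (e.1 ∘ Equiv.swap (0 : Fin 4) i, Equiv.swap (0 : Fin 4) i e.2))
        (pos c q) = plaquetteDeficit ρ U (pos (c ∘ Equiv.swap (0 : Fin 4) i) (sw q)))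
    (hcomm : ∀ q, sw (fli q) = fl0 (sw q))
    (W : GaugeConfig 4 L G → ℂ) (hWm : Measurable W) (hWb : ∃ C, ∀ U, ‖W U‖ ≤ C)
    (hWr : ∀ U, conj (W U) = W U) (hWΘ : ∀ U, W (GaugeConfig.negReflect U) = W U)
    (hWσ : ∀ U, W (fun e => U (e.1 ∘ Equiv.swap (0 : Fin 4) i, Equiv.swap (0 : Fin 4) i e.2)) = W U)
    (hpos : ∀ F : GaugeConfig 4 L G → ℂ, WilsonSiteRP.IsHalfObs F →
      0 ≤ ∫ U, conj (F (GaugeConfig.negReflect U)) * F U * W U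
        ∂(Measure.pi fun _ : Edge 4 L => haarProbability G))
    (w : (Fin 4 → ZMod L) → Finset κ) :
    0 ≤ (∫ U, {U : GaugeConfig 4 L G | ∀ c, ∀ q ∈ (fun c => if (c i).val < L / 2 then w c
          else (w (Function.update c i (-1 - c i))).image fli) c, δ ≤ plaquetteDeficit ρ U (pos c q)}.indicator
          1 U * W U ∂(Measure.pi fun _ : Edge 4 L => haarProbability G)).re ∧
    (∫ U, {U : GaugeConfig 4 L G | ∀ c, ∀ q ∈ w c, δ ≤ plaquetteDeficit ρ U (pos c q)}.indicator 1 U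
        * W U ∂(Measure.pi fun _ : Edge 4 L => haarProbability G)).re ^ 2 ≤
      (∫ U, {U : GaugeConfig 4 L G | ∀ c, ∀ q ∈ (fun c => if (c i).val < L / 2 then w c
          else (w (Function.update c i (-1 - c i))).image fli) c, δ ≤ plaquetteDeficit ρ U (pos c q)}.indicator
          1 U * W U ∂(Measure.pi fun _ : Edge 4 L => haarProbability G)).re *
      (∫ U, {U : GaugeConfig 4 L G | ∀ c, ∀ q ∈ (fun c => if (c i).val < L / 2
          then (w (Function.update c i (-1 - c i))).image fli else w c) c,
          δ ≤ plaquetteDeficit ρ U (pos c q)}.indicator 1 U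
        * W U ∂(Measure.pi fun _ : Edge 4 L => haarProbability G)).re := by
  have key := chess_axis0 ρ δ pos hL hρ hfl0 hpr hloc W hWm hWb hWr hWΘ hpos
    (fun c => (w (c ∘ Equiv.swap (0 : Fin 4) i)).image sw)
  have e0 := asm_phi_axisSwap ρ δ pos i hsw W hWσ w
  have e1 := asm_phi_axisSwap ρ δ pos i hsw W hWσ (fun c => if (c i).val < L / 2 then w c
    else (w (Function.update c i (-1 - c i))).image fli)
  have e2 := asm_phi_axisSwap ρ δ pos i hsw W hWσ (fun c => if (c i).val < L / 2
    then (w (Function.update c i (-1 - c i))).image fli else w c)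
  have f1 := asm_swapWord_half₁ (L := L) i hcomm w
  have f2 := asm_swapWord_half₂ (L := L) i hcomm w
  simp only [funext_iff] at f1 f2
  beta_reduce at key e0 e1 e2 f1 f2 ⊢
  simp only [f1] at e1
  simp only [f2] at e2
  rw [← e0, ← e1, ← e2]
  exact key

end MainAxis



end Summit.QuantumFields.QCD.Theorems.UnquenchedChessboardBoundLine

end
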